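/-
Copyright: lead seat `ym-line-sll-p1` (prover-ym-line-sll-p1-g0-0), route `SoftLoopLongLag`, crux `ColdBoxSoftLoopLagFloor`
(stmt-QuantumFields-24180; stub E1b `stub_innerDatumCovStabilityG` of `Cruxes/ColdBoxSoftLoopLagFloor/Lines/birth.lean` v7).
-/
import Summits.QuantumFields.YangMills.Theorems.SoftLoopLongLagDirichletLoopInductance
import Summits.QuantumFields.YangMills.Theorems.SoftLoopLongLagFreeMaxwellLagPositivity

/-!
# Lag positivity survives the cold wall: the DIRICHLET loop-inductance quadratic form at lag `T` is `≥ −K·R⁴/H⁴·(Σ|w|)²` near the centre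
# (route `SoftLoopLongLag`, G-free; the sign of the background LINEAR term of stub E1b)

WHAT.  For weights `w : ℤ⁴ → ℝ` on the time-zero cube `cube_R` and the Dirichlet mutual inductances of the cold-wall box `[0,2H]⁴`
(`Σ_{p ∈ S(x+c)} Σ_{q ∈ S(x'+c+Te₀)} boxDirProjKernel H p q`, `S(y)` = spanning surface of the `R×R` square at `y` in the `(1,2)` plane, any centre `c`),
`Σ_{x,x'} w_x w_{x'} M_D(S(x+c), S(x'+c+Te₀)) ≥ −(K·R⁴/H⁴)·(Σ_x |w_x|)²` as soon as all these surfaces are based within sup-distance `H/8` of `boxCentre H`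
and `H ≥ 32` (`sum_sum_mul_mul_dirInductance_lag_ge`).  Ingredients: the free lag positivity on `ℤ⁴` (tree `sum_sum_mul_mul_mutualInductance_lag_nonneg`,
reflection positivity of the free lattice Maxwell field in the time direction), stationarity `mutualInductance_shift`, and the Dirichlet-vs-free comparison
`|M_D − M| ≤ K·R⁴/H⁴` of width seat ym-line-sll-p4 (`exists_abs_dirInductance_sub_mutualInductance_le`).  A convenience form with a uniform weight bound
(`(Σ|w|)² ≤ (#cube_R·A)²`) is `sum_sum_mul_mul_dirInductance_lag_ge_of_abs_le`.

WHY.  In the one-scale expansion with a crude-good datum (stub E1b) the Gaussian covariance of the cube-smeared loop observable carries the LINEAR background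
term `(Σ_c F_c(x)F_c(x'))·M_D(x,x')` (tree `cov_gp_quad_pi_eq`); its equal-weight part is this quadratic form with `w = F_c`, hence harmless up to
`K·R⁴/H⁴·(#cube·max F²)` — polynomially small at `H = β^{31ε/4}`.

HONEST LABEL.  Free-field bookkeeping for a RECORD-label rung line (R2xi-G, leaf `WeakCouplingRates.XiPow` = an UPPER bound on the lattice mass gap,
all compact simple `G`); NOT the Clay mass gap; no summit statement is touched.

References: J. Fröhlich, R. Israel, E. Lieb, B. Simon, CMP 62 (1978) §3 (lattice RP); C. Garban, A. Sepúlveda, IMRN 2023 §4.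
-/

set_option autoImplicit false

noncomputable section

open Finset
open Literature.Probability.LatticeModels (Site)
open Literature.MathematicalPhysics.QuantumLattice (ZdPlaquette)
open Literature.MathematicalPhysics.QuantumFieldTheory
open Summit.QuantumFields.YangMills.Theorems.WeakCouplingRates

namespace Summit.QuantumFields.YangMills.Theorems.SoftLoopLongLag

/-- **Dirichlet lag positivity up to the wall correction**: with the constant `K` of `exists_abs_dirInductance_sub_mutualInductance_le`, for `H ≥ 32`,
every lag `T`, centre `c` and weights `w`, if all the spanning surfaces `S(x+c)`, `S(x'+c+Te₀)` (`x, x' ∈ cube_R`) are based within `H/8` of `boxCentre H`,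
then `−(K·R⁴/H⁴)·(Σ_x |w_x|)² ≤ Σ_{x,x'} w_x w_{x'} M_D(S(x+c), S(x'+c+Te₀))`. -/
theorem sum_sum_mul_mul_dirInductance_lag_ge :
    ∃ K : ℝ, 0 ≤ K ∧ ∀ (H : ℕ), (32 : ℝ) ≤ H → ∀ (R T : ℕ) (c : Site 4) (w : Site 4 → ℝ),
      (∀ x ∈ timeZeroCube R, ∀ p ∈ rectSurface (x + c) R R, ‖p.1 - boxCentre H‖ ≤ (H : ℝ) / 8) →
      (∀ x' ∈ timeZeroCube R, ∀ q ∈ rectSurface (x' + c + Pi.single 0 (T : ℤ)) R R, ‖q.1 - boxCentre H‖ ≤ (H : ℝ) / 8) →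
      -(K * (R : ℝ) ^ 4 / (H : ℝ) ^ 4 * (∑ x ∈ timeZeroCube R, |w x|) ^ 2) ≤
        ∑ x ∈ timeZeroCube R, ∑ x' ∈ timeZeroCube R, w x * w x' *
          ∑ p ∈ rectSurface (x + c) R R, ∑ q ∈ rectSurface (x' + c + Pi.single 0 (T : ℤ)) R R,
            boxDirProjKernel H ((p.1, p.2.1.1, p.2.1.2) : Plaq 4) ((q.1, q.2.1.1, q.2.1.2) : Plaq 4) := by
  obtain ⟨K, hK0, hK⟩ := exists_abs_dirInductance_sub_mutualInductance_le
  refine ⟨K, hK0, fun H hH R T c w hS hS' => ?_⟩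
  set E : ℝ := K * (R : ℝ) ^ 4 / (H : ℝ) ^ 4 with hE
  have hE0 : 0 ≤ E := by rw [hE]; positivity
  -- a purely real step: `|D − M| ≤ E ⇒ a b M − |a||b| E ≤ a b D`
  have key : ∀ {D M a b : ℝ}, |D - M| ≤ E → a * b * M - |a| * |b| * E ≤ a * b * D := by
    intro D M a b h
    have hprod : |a * b * (D - M)| ≤ |a| * |b| * E := by
      rw [abs_mul, abs_mul]; exact mul_le_mul_of_nonneg_left h (by positivity)
    have hneg := neg_abs_le (a * b * (D - M))
    have e : a * b * (D - M) = a * b * D - a * b * M := by ring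
    linarith
  -- stationarity of the free inductance under the common shift `c`
  have hshift : ∀ x x' : Site 4, mutualInductance (x + c) (x' + c + Pi.single 0 (T : ℤ)) R =
      mutualInductance x (x' + Pi.single 0 (T : ℤ)) R := fun x x' => by
    rw [add_right_comm x' c]
    exact mutualInductance_shift x _ c R
  -- termwise lower bound, summed
  have hlow : ∑ x ∈ timeZeroCube R, ∑ x' ∈ timeZeroCube R,
      (w x * w x' * mutualInductance x (x' + Pi.single 0 (T : ℤ)) R - |w x| * |w x'| * E) ≤
      ∑ x ∈ timeZeroCube R, ∑ x' ∈ timeZeroCube R, w x * w x' *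
          ∑ p ∈ rectSurface (x + c) R R, ∑ q ∈ rectSurface (x' + c + Pi.single 0 (T : ℤ)) R R,
            boxDirProjKernel H ((p.1, p.2.1.1, p.2.1.2) : Plaq 4) ((q.1, q.2.1.1, q.2.1.2) : Plaq 4) := by
    refine Finset.sum_le_sum fun x hx => Finset.sum_le_sum fun x' hx' => ?_
    have h := hK H hH _ _ R (hS x hx) (hS' x' hx')
    rw [hshift] at h
    exact key h
  refine le_trans ?_ hlow
  simp only [Finset.sum_sub_distrib]
  have hpos := sum_sum_mul_mul_mutualInductance_lag_nonneg R T w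
  have habs : ∑ x ∈ timeZeroCube R, ∑ x' ∈ timeZeroCube R, |w x| * |w x'| * E = E * (∑ x ∈ timeZeroCube R, |w x|) ^ 2 := by
    rw [sq, Finset.sum_mul_sum, Finset.mul_sum]
    refine Finset.sum_congr rfl fun x _ => ?_
    rw [Finset.mul_sum]
    exact Finset.sum_congr rfl fun x' _ => by ring
  rw [habs]
  linarith

/-- **Uniform-weight form**: if moreover `|w_x| ≤ A` on the cube, the quadratic form is `≥ −(K·R⁴/H⁴)·(#cube_R·A)²`. -/
theorem sum_sum_mul_mul_dirInductance_lag_ge_of_abs_le :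
    ∃ K : ℝ, 0 ≤ K ∧ ∀ (H : ℕ), (32 : ℝ) ≤ H → ∀ (R T : ℕ) (c : Site 4) (w : Site 4 → ℝ) (A : ℝ),
      (∀ x ∈ timeZeroCube R, |w x| ≤ A) →
      (∀ x ∈ timeZeroCube R, ∀ p ∈ rectSurface (x + c) R R, ‖p.1 - boxCentre H‖ ≤ (H : ℝ) / 8) →
      (∀ x' ∈ timeZeroCube R, ∀ q ∈ rectSurface (x' + c + Pi.single 0 (T : ℤ)) R R, ‖q.1 - boxCentre H‖ ≤ (H : ℝ) / 8) →
      -(K * (R : ℝ) ^ 4 / (H : ℝ) ^ 4 * (((timeZeroCube R).card : ℝ) * A) ^ 2) ≤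
        ∑ x ∈ timeZeroCube R, ∑ x' ∈ timeZeroCube R, w x * w x' *
          ∑ p ∈ rectSurface (x + c) R R, ∑ q ∈ rectSurface (x' + c + Pi.single 0 (T : ℤ)) R R,
            boxDirProjKernel H ((p.1, p.2.1.1, p.2.1.2) : Plaq 4) ((q.1, q.2.1.1, q.2.1.2) : Plaq 4) := by
  obtain ⟨K, hK0, hK⟩ := sum_sum_mul_mul_dirInductance_lag_ge
  refine ⟨K, hK0, fun H hH R T c w A hw hS hS' => le_trans ?_ (hK H hH R T c w hS hS')⟩
  have hsum : ∑ x ∈ timeZeroCube R, |w x| ≤ ((timeZeroCube R).card : ℝ) * A := by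
    have := Finset.sum_le_sum hw
    simpa [Finset.sum_const, nsmul_eq_mul] using this
  have h0s : 0 ≤ ∑ x ∈ timeZeroCube R, |w x| := Finset.sum_nonneg fun x _ => abs_nonneg _
  have hsq : (∑ x ∈ timeZeroCube R, |w x|) ^ 2 ≤ (((timeZeroCube R).card : ℝ) * A) ^ 2 := pow_le_pow_left₀ h0s hsum 2
  have hE0 : 0 ≤ K * (R : ℝ) ^ 4 / (H : ℝ) ^ 4 := by positivity
  nlinarith [mul_le_mul_of_nonneg_left hsq hE0]

end Summit.QuantumFields.YangMills.Theorems.SoftLoopLongLag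

end
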